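import Mathlib.Analysis.InnerProductSpace.PiL2
import Mathlib.Analysis.Normed.Operator.Mul
import HarnessLib

/-!
# Strain doors — continuity of the vorticity-direction gradient formula (engine lemma for PART M, ROUND 61/62)

`Summit.NavierStokesRegularity.NavierStokesRegularity.Theorems.StrainDoors` (S-door lane of the
ns-regularity-ideate cell, helper lane of `stmt-NavierStokesRegularity-0056`; prover hand ns-s29-p2 g6).

The derivative of the direction field `ξ = ω/|ω|` delivered by the tree's `hasFDerivAt_vorticityDirection` is
the bilinear expression `Φ(a, B) = |a|⁻¹ • B + ((−|a|⁻³) • ⟪a, B·⟫) ⊗ a` in the value `a = ω(x) ≠ 0` and the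
gradient `B = ∇ω(x)`.  This file proves the one routine fact the planner's PART M §M4 («second-order tangent
convergence at moving points») needs and records as an open stub (`r61/M_formula_stub.lean`,
`tendsto_vorticityDirection_fderiv_formula`): `Φ` is jointly continuous at every `(ā, B̄)` with `ā ≠ 0`, in
sequential form.  The two bilinear continuities (`(L, B) ↦ L ∘ B` and `(L, a) ↦ L(·) • a`) are taken from the
continuous bilinear maps `ContinuousLinearMap.compL` / `ContinuousLinearMap.smulRightL`; each composite limit
is bound WITHOUT an expected type first (elaborating the composition against the target statement directly
exhausts the `whnf` heartbeat budget — the failure mode recorded in the stub).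

No Navier–Stokes content; nothing here bears on `NoTypeII` / Type-I Liouville beyond serving PART M.
-/

noncomputable section

open Filter InnerProductSpace
open _root_.Topology

namespace Summit.NavierStokesRegularity.NavierStokesRegularity.Theorems.StrainDoors

/-- Composition with a convergent sequence of functionals: `L_j → L̄` and `B_j → B̄` (operator norms) give
`L_j ∘ B_j → L̄ ∘ B̄`. [folklore] -/
theorem tendsto_clm_comp_of_tendsto
    {L : ℕ → (EuclideanSpace ℝ (Fin 3)) →L[ℝ] ℝ} {Lbar : (EuclideanSpace ℝ (Fin 3)) →L[ℝ] ℝ}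
    {B : ℕ → (EuclideanSpace ℝ (Fin 3)) →L[ℝ] (EuclideanSpace ℝ (Fin 3))}
    {Bbar : (EuclideanSpace ℝ (Fin 3)) →L[ℝ] (EuclideanSpace ℝ (Fin 3))}
    (hL : Tendsto L atTop (𝓝 Lbar)) (hB : Tendsto B atTop (𝓝 Bbar)) :
    Tendsto (fun j => (L j).comp (B j)) atTop (𝓝 (Lbar.comp Bbar)) := by
  have key : Continuous (fun p : ((EuclideanSpace ℝ (Fin 3)) →L[ℝ] ℝ) ×
      ((EuclideanSpace ℝ (Fin 3)) →L[ℝ] (EuclideanSpace ℝ (Fin 3))) => p.1.comp p.2) :=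
    (ContinuousLinearMap.compL ℝ (EuclideanSpace ℝ (Fin 3)) (EuclideanSpace ℝ (Fin 3)) ℝ).continuous₂
  have h3 : Tendsto (fun j => (L j, B j)) atTop (𝓝 (Lbar, Bbar)) := hL.prodMk_nhds hB
  have h4 := (key.tendsto (Lbar, Bbar)).comp h3
  exact h4

/-- Rank-one maps with convergent factors: `L_j → L̄` (operator norm) and `a_j → ā` give
`(L_j(·) • a_j) → (L̄(·) • ā)`. [folklore] -/
theorem tendsto_clm_smulRight_of_tendsto
    {L : ℕ → (EuclideanSpace ℝ (Fin 3)) →L[ℝ] ℝ} {Lbar : (EuclideanSpace ℝ (Fin 3)) →L[ℝ] ℝ}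
    {a : ℕ → EuclideanSpace ℝ (Fin 3)} {abar : EuclideanSpace ℝ (Fin 3)}
    (hL : Tendsto L atTop (𝓝 Lbar)) (ha : Tendsto a atTop (𝓝 abar)) :
    Tendsto (fun j => (L j).smulRight (a j)) atTop (𝓝 (Lbar.smulRight abar)) := by
  have key : Continuous (fun p : ((EuclideanSpace ℝ (Fin 3)) →L[ℝ] ℝ) × (EuclideanSpace ℝ (Fin 3)) =>
      p.1.smulRight p.2) :=
    (ContinuousLinearMap.smulRightL ℝ (EuclideanSpace ℝ (Fin 3)) (EuclideanSpace ℝ (Fin 3))).continuous₂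
  have h3 : Tendsto (fun j => (L j, a j)) atTop (𝓝 (Lbar, abar)) := hL.prodMk_nhds ha
  have h4 := (key.tendsto (Lbar, abar)).comp h3
  exact h4

/-- **Continuity of the direction-gradient formula** (the planner's stub `tendsto_vorticityDirection_fderiv_formula`,
r61/M_formula_stub.lean, verbatim statement): if `a_j → ā ≠ 0` and `B_j → B̄` then `Φ(a_j, B_j) → Φ(ā, B̄)` for
`Φ(a,B) = |a|⁻¹ • B + ((−(|a|³)⁻¹) • ⟪a, B·⟫) ⊗ a`, the derivative of `ξ = ω/|ω|` delivered by the tree's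
`hasFDerivAt_vorticityDirection`. [folklore] -/
theorem tendsto_vorticityDirection_fderiv_formula
    {a : ℕ → EuclideanSpace ℝ (Fin 3)} {abar : EuclideanSpace ℝ (Fin 3)}
    {B : ℕ → (EuclideanSpace ℝ (Fin 3)) →L[ℝ] (EuclideanSpace ℝ (Fin 3))}
    {Bbar : (EuclideanSpace ℝ (Fin 3)) →L[ℝ] (EuclideanSpace ℝ (Fin 3))}
    (ha : Tendsto a atTop (𝓝 abar)) (hne : abar ≠ 0) (hB : Tendsto B atTop (𝓝 Bbar)) :
    Tendsto (fun j => ‖a j‖⁻¹ • B j + ((-(‖a j‖ ^ 3)⁻¹) • (innerSL ℝ (a j)).comp (B j)).smulRight (a j))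
      atTop (𝓝 (‖abar‖⁻¹ • Bbar + ((-(‖abar‖ ^ 3)⁻¹) • (innerSL ℝ abar).comp Bbar).smulRight abar)) := by
  have hρ : ‖abar‖ ≠ 0 := norm_ne_zero_iff.mpr hne
  have t1 : Tendsto (fun j => ‖a j‖⁻¹ • B j) atTop (𝓝 (‖abar‖⁻¹ • Bbar)) := (ha.norm.inv₀ hρ).smul hB
  have hin : Tendsto (fun j => innerSL ℝ (a j)) atTop (𝓝 (innerSL ℝ abar)) :=
    ((innerSL ℝ (E := EuclideanSpace ℝ (Fin 3))).continuous.tendsto abar).comp ha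
  have hcomp : Tendsto (fun j => (innerSL ℝ (a j)).comp (B j)) atTop (𝓝 ((innerSL ℝ abar).comp Bbar)) :=
    tendsto_clm_comp_of_tendsto hin hB
  have hcoef : Tendsto (fun j => -(‖a j‖ ^ 3)⁻¹) atTop (𝓝 (-(‖abar‖ ^ 3)⁻¹)) :=
    ((ha.norm.pow 3).inv₀ (pow_ne_zero 3 hρ)).neg
  have t2pre : Tendsto (fun j => (-(‖a j‖ ^ 3)⁻¹) • (innerSL ℝ (a j)).comp (B j)) atTop
      (𝓝 ((-(‖abar‖ ^ 3)⁻¹) • (innerSL ℝ abar).comp Bbar)) := hcoef.smul hcomp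
  have t2 : Tendsto (fun j => ((-(‖a j‖ ^ 3)⁻¹) • (innerSL ℝ (a j)).comp (B j)).smulRight (a j)) atTop
      (𝓝 (((-(‖abar‖ ^ 3)⁻¹) • (innerSL ℝ abar).comp Bbar).smulRight abar)) :=
    tendsto_clm_smulRight_of_tendsto t2pre ha
  exact t1.add t2

end Summit.NavierStokesRegularity.NavierStokesRegularity.Theorems.StrainDoors

end
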